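import Summits.BirchSwinnertonDyer.Rank1Residual.X2.HidaLimitCongruenceAlgebra
import Summits.BirchSwinnertonDyer.Rank1Residual.X2.NonsplitIMCEqHalves
import Summits.BirchSwinnertonDyer.Rank1Residual.X2.SplitHalvesOnTree
import Summits.BirchSwinnertonDyer.Rank1Residual.X11b.AnticyclotomicModuleFinite
import HarnessLib

/-!
# O9 (row B11): road H's INPUTS as one typed predicate — `HidaLimitInputsAt W p` (Keller–Yin §5
# (a)–(e) member data: (α) + control, (d) member IMC, (b) two-variable `L`-function, finite-submodule
# bound) — and the kernel transfer to the IMC atom c3 / c3s at BOTH signs (cell `bsd-eis`, seat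
# `bsd-eis-cgshw` g8; route `EisensteinPrimes`, crux 4 `BSDpOnCellC`, line b1; MEMO-8 §11 companion,
# released by referee g23 §1: «the Lean companion may proceed as planned in §11»)

HONEST FRAMING (cell `bsd-eis`, run/shared/lean/pub/bsd-eis/): ONE hypothesis-shaped
`@[conjecture]` predicate + theorems; nothing asserted; nothing booked; X2 stays
CONSTRUCTION-SHAPED; no label or count moves. No stub of the registered skeleton b1 is attacked or
renamed: this file TYPES road H's inputs and GLUES them to the EXISTING c3 halves.

## What and why

Road H (the Hida-limit road to B11's IMC atom; ky MEMO-2 Thm. D″, cgshw MEMO-8 and MEMO-9) reads, member by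
member along the ordinary Hida family through `f_E` at an Eisenstein `p ‖ N`: for every `m ≥ 1`
there are a finite `Λ`-module `N_m` (`𝔛_{f_m}` of the good member `f_m` of weight
`k_m ≡ 2 (mod 2(p−1))`, `f_m ≡ f_E (mod p^m)`), a series `L_m ∈ Λ^nr = R₀⟦T⟧` (`𝓛_{f_m}`), and
 (e) a `Λ`-isomorphism `X_ac^∅/p^m ≅ N_m/p^m` [(α) lattice congruences `T_{f_m}/p^m ≅ T/p^m` — cgshw
     MEMO-9: from the étaleness of the ordinary family at the p-new weight-2 point (Hida 1986
     Cor. 1.3/1.4; p = 3 via EMIT Thm. 4.2.37) — + anticyclotomic control, KY §5 (c)/(e)],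
 (d) `Fitt_Λ(N_m)·R₀⟦T⟧ ⊆ (L_m)` [the member's anticyclotomic IMC, KY Thm. 3.0.8 — only `⊆` of the
     equality is used; its printed weight-vs-`p` hypotheses removed by cgshw MEMO-8 (bounded
     denominators, all weights)],
 (b) `(L_m) + (p)^m = (L) + (p)^m` in `R₀⟦T⟧` [Castella JIMJ 19 (2020) §1.5 two-variable function;
     `p ∤ h_K` a convenience — MEMO-9 v1.2 (d): the device over `G̃ = Gal(K[p^∞]/K)` is CH18 §3.3],
 and ONE exponent `a` with `(p)^a·(F) ⊆ Fitt_Λ(X_ac^∅)` for a generator `F` of `Ch_Λ(X_ac^∅)` [the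
 finite submodule of the FIXED module; KY Lemma 5.1.2 shape].
`HidaLimitInputsAt W p` packages exactly this, SIGN-FREE (KY Thm. C / 5.1.3 carry no sign
hypothesis; at a split `p` the members have the anomalous local type KY §§1–3 allow), on the binders
of `NonsplitIMCEqOnTree` / `SplitIMCEqOnTree` WITHOUT the sign binder and for every `R₀`-frame `L`.
The kernel then does the rest:
* `C_pow_mul_map_mem_of_hidaLimitInputs` — inputs ⟹ `∃ a, C(p^a)·F^nr ∈ (L)` (the body of
  `X2.HidaLimitRevDivOnTree`, p419866) by the pure-algebra theorem
  `HidaLimitAlgebra.C_pow_mul_map_mem_span_of_oneSided_congruences` (one-sided REVERSE congruence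
  limit across `Λ → Λ^nr`, Krull over the Noetherian `R₀⟦T⟧`; `X_ac^∅` finitely generated by the
  tree's PROVED `XAc.module_finite_empty`);
* `nonsplitIMCEqOnTree_of_hidaLimitInputs_of_muLambda` / `splitIMCEqOnTree_of_hidaLimitInputs_of_muLambda`
  — inputs + Keller–Yin D′ (`NonsplitMuLambdaOnTree` p408417 / `SplitMuLambdaOnTree` p416318)
  ⟹ c3 / c3s, by `span_singleton_eq_of_C_pow_mul_mem` (p406792) with the roles of `F` and `L`
  exchanged; `imcEq_both_signs_of_hidaLimitInputs_of_muLambda` bundles both signs.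
So the IMC atom of crux 4 reads, at either sign: `(c3-div ∨ HidaLimitInputs) ∧ c3-μλ`, with road H's
residual carried by ONE named predicate whose every field has a memo-level derivation from published
inputs (riders: KY PRE). The bridge `HidaLimitInputsAt → HidaLimitRevDivOnTree` is immediate from
`C_pow_mul_map_mem_of_hidaLimitInputs` and is left to a 10-line file once `X2/HidaLimitRoad.lean`'s
olean is on the farm (it is not imported here for that reason only).

What this is NOT: not a proof of (α), (b) or (d); not a claim that KY Thm. D is a theorem (PRE); the
`Int` (`𝓞_{ℂ_p}`-frame) twin of k5-c4's receptacle is a separate file (planner L9-a r2).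

References: Keller–Yin arXiv:2402.12781v2 §5.1 (a)–(e), Lemma 5.1.2, Thm. 5.1.3, Thm. 3.0.8
[KellerYin2024, PRE]; Hida, Invent. Math. 85 (1986) Cor. 1.3/1.4 [Hida1986]; Castella, JIMJ 19
(2020) §1.5 [Castella2020]; C. Skinner, Pacific J. Math. 283 (2016) §3.1 [Skinner2016PacificMC];
cell memos bsd-eis-ky MEMO-2 §4–§5, cgshw MEMO-8 (v1.3) §11, MEMO-9 (v1.2).
-/

set_option autoImplicit false

noncomputable section

open scoped Classical MatrixGroups ModularForm

open CongruenceSubgroup WeierstrassCurve NumberField IsDedekindDomain Field PowerSeries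
  Literature.RingTheory.FittingIdeal
  Literature.NumberTheory.EllipticCurves Literature.NumberTheory.EllipticCurves.GreenbergSelmer
  Literature.NumberTheory.EllipticCurves.ModularForms
  Literature.NumberTheory.EllipticCurves.Rank1Residual
  Literature.NumberTheory.EllipticCurves.Rank1Residual.Typed
  Literature.NumberTheory.GaloisRepresentations Literature.NumberTheory.GaloisCohomology
  Literature.NumberTheory.Automorphic
  Summit.BirchSwinnertonDyer.Rank1Residual.X11b.AcSelmer
  Summit.BirchSwinnertonDyer.Rank1Residual.X11b.Halves
  Summit.BirchSwinnertonDyer.Rank1Residual.X11b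
  Summit.BirchSwinnertonDyer.Rank1Residual.X1.KellerYinHalves

namespace Summit.BirchSwinnertonDyer.Rank1Residual.X2

section Inputs

variable (W : WeierstrassCurve ℚ) [W.IsElliptic] [W.IsGloballyMinimal] (p : ℕ) [Fact p.Prime]

/-- **`HidaLimitInputsAt W p` — the INPUTS of the Hida-limit road H (Keller–Yin §5 (a)–(e)) at an X2c
pair, BOTH signs, as ONE hypothesis-shaped predicate.** On the binders of `NonsplitIMCEqOnTree` /
`SplitIMCEqOnTree` without the sign binder (X2c Heegner datum, anticyclotomic `κ` with generator `γ`,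
degree-one `𝔭 ∋ p`, newform, embedding datum, an `R₀`-frame `(Ω_K, Ω_p, L)`) and for every
generator `F` of `Ch_Λ(X_ac^∅(E[p^∞]))`: there is an exponent `a` with `(p)^a·(F) ⊆ Fitt_Λ(X_ac^∅)`
[finite submodule of the fixed module; KY Lemma 5.1.2], and for every `m ≥ 1` a finite `Λ`-module
`N_m` [`𝔛_{f_m}` of the congruent good member `f_m`, KY §5 (a)], a series `L_m ∈ R₀⟦T⟧`
[`𝓛_{f_m}`], a `Λ`-isomorphism `X_ac^∅/p^m ≅ N_m/p^m` [(α) lattice congruences — NOT in print for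
residually reducible `f`; cgshw MEMO-9: from the étaleness of the ordinary family at `f_E`, Hida 1986
Cor. 1.3/1.4 (p = 3: EMIT Thm. 4.2.37) — composed with anticyclotomic control, KY §5 (c)/(e)], the
member inclusion `Fitt_Λ(N_m)·R₀⟦T⟧ ⊆ (L_m)` [(d): KY Thm. 3.0.8 for `f_m`, PRE; weight-vs-`p`
hypotheses of its printed sources removed by cgshw MEMO-8], and `(L_m) + (p)^m = (L) + (p)^m` in
`R₀⟦T⟧` [(b): Castella JIMJ 2020 §1.5; `p ∤ h_K` a convenience, MEMO-9 v1.2]. TYPED, not attempted;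
nothing asserted; every result using it is CONDITIONAL. [claim: KellerYin2024, status: under-review]
[cite: KellerYin2024, §5.1 (a)–(e), Lemma 5.1.2, Thm. 5.1.3 and Thm. 3.0.8 (arXiv:2402.12781v2)]
[cite: Hida1986, Cor. 1.3 and Cor. 1.4 (Invent. Math. 85, pp. 554–555)]
[cite: Skinner2016PacificMC, §3.1 (p. 192) (shape of the congruence data)] -/
@[conjecture]
def HidaLimitInputsAt : Prop :=
  ∀ (N : ℕ) [NeZero N] (K : Type) [Field K] [NumberField K] (Dt : ModularParametrizationData W N)
    (H : HeegnerDatum N (NumberField.discr K)) (ιK : K →+* ℂ) (P : (W.baseChange K).toAffine.Point),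
    CellC W p → W.conductorNorm ℤ = N →
    IsImaginaryQuadratic K → NumberField.discr K < -4 → SatisfiesHeegnerHypothesis N K →
    (W.quadraticTwist (NumberField.discr K : ℚ)).entireLFunction 1 ≠ 0 →
    WeierstrassCurve.Affine.Point.map ιK.toRatAlgHom P = heegnerPointComplex Dt H →
    ¬ (p : ℤ) ∣ Dt.c → ¬ IsOfFinAddOrder P →
    ∀ (κ : ZpExtension K p), κ.IsAnticyclotomic →
      ∀ (γ : Field.absoluteGaloisGroup K) [Fact (κ.IsTopGenerator γ)]
        (𝔭 : HeightOneSpectrum (𝓞 K)), ((p : ℕ) : 𝓞 K) ∈ 𝔭.asIdeal →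
        𝔭.asIdeal.ramificationIdx (𝓞 ℚ) = 1 → 𝔭.asIdeal.inertiaDeg (𝓞 ℚ) = 1 →
        ∀ (f : CuspForm (CongruenceSubgroup.Gamma0 N) 2), IsNewformOf W f →
          ∀ (ι' : PadicAlgCl p ≃+* ℂ),
            (∀ (w : InfinitePlace K) (k : 𝓞 K),
              k ∈ 𝔭.asIdeal ↔ ‖ι'.symm (w.embedding (k : K))‖ < 1) →
            ∀ (ΩK : ℂ) (Ωp : (unrIntegers p)ˣ) (L : UnrSeries p), ΩK ≠ 0 →
              IsBDPLFunction ι' 𝔭 κ γ f ΩK ((Ωp : unrIntegers p) : ℂ_[p]) L →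
                ∀ F : IwasawaAlgebra p,
                  XAc.charIdeal (W.baseChange K) p κ 𝔭 ∅ γ = Ideal.span {F} →
                  (∃ a : ℕ, Ideal.span {(C (p : ℤ_[p]) : IwasawaAlgebra p)} ^ a * Ideal.span {F} ≤
                      Module.fittingIdeal (IwasawaAlgebra p) (XAc (W.baseChange K) p κ 𝔭 ∅ γ) 0) ∧
                  ∀ m : ℕ, 1 ≤ m →
                    ∃ (Nm : Type) (_ : AddCommGroup Nm) (_ : Module (IwasawaAlgebra p) Nm)
                      (_ : Module.Finite (IwasawaAlgebra p) Nm) (Lm : UnrSeries p),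
                      Nonempty (((XAc (W.baseChange K) p κ 𝔭 ∅ γ) ⧸
                          ((Ideal.span {(C (p : ℤ_[p]) : IwasawaAlgebra p)}) ^ m •
                            (⊤ : Submodule (IwasawaAlgebra p) (XAc (W.baseChange K) p κ 𝔭 ∅ γ))))
                          ≃ₗ[IwasawaAlgebra p]
                        (Nm ⧸ ((Ideal.span {(C (p : ℤ_[p]) : IwasawaAlgebra p)}) ^ m •
                          (⊤ : Submodule (IwasawaAlgebra p) Nm)))) ∧
                      (Module.fittingIdeal (IwasawaAlgebra p) Nm 0).map (PowerSeries.map (toUnr p)) ≤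
                        Ideal.span {Lm} ∧
                      Ideal.span {Lm} ⊔ (Ideal.span {(C ((p : ℕ) : unrIntegers p) : UnrSeries p)}) ^ m =
                        Ideal.span {L} ⊔ (Ideal.span {(C ((p : ℕ) : unrIntegers p) : UnrSeries p)}) ^ m

end Inputs

/-! ### The kernel transfer: inputs ⟹ `C(p^a)·F^nr ∈ (L)` (road H's output), pure algebra -/

section Transfer

variable {p : ℕ} [Fact p.Prime]

/-- **Member data ⟹ the reverse divisibility, for ONE finite `Λ`-module `X`** (the shape of the inner
package of `HidaLimitInputsAt`, discharged by `HidaLimitAlgebra.C_pow_mul_map_mem_span_of_oneSided_congruences`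
after choosing the member modules into a family; level `m = 0` is padded with `X` itself, where every
requirement is vacuous). Pure algebra; nothing about any curve. [cite: Skinner2016PacificMC, §3.1 (p. 192)]
[cite: KellerYin2024, §5.1 (a)–(e) (arXiv:2402.12781v2) (shape only)] -/
theorem C_pow_mul_map_mem_of_memberData {X : Type} [AddCommGroup X] [Module (IwasawaAlgebra p) X]
    [Module.Finite (IwasawaAlgebra p) X] {F : IwasawaAlgebra p} {L : UnrSeries p} {a : ℕ}
    (hfitt : Ideal.span {(C (p : ℤ_[p]) : IwasawaAlgebra p)} ^ a * Ideal.span {F} ≤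
      Module.fittingIdeal (IwasawaAlgebra p) X 0)
    (hmem : ∀ m : ℕ, 1 ≤ m →
      ∃ (Nm : Type) (_ : AddCommGroup Nm) (_ : Module (IwasawaAlgebra p) Nm)
        (_ : Module.Finite (IwasawaAlgebra p) Nm) (Lm : UnrSeries p),
        Nonempty ((X ⧸ ((Ideal.span {(C (p : ℤ_[p]) : IwasawaAlgebra p)}) ^ m •
            (⊤ : Submodule (IwasawaAlgebra p) X))) ≃ₗ[IwasawaAlgebra p]
          (Nm ⧸ ((Ideal.span {(C (p : ℤ_[p]) : IwasawaAlgebra p)}) ^ m •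
            (⊤ : Submodule (IwasawaAlgebra p) Nm)))) ∧
        (Module.fittingIdeal (IwasawaAlgebra p) Nm 0).map (PowerSeries.map (toUnr p)) ≤
          Ideal.span {Lm} ∧
        Ideal.span {Lm} ⊔ (Ideal.span {(C ((p : ℕ) : unrIntegers p) : UnrSeries p)}) ^ m =
          Ideal.span {L} ⊔ (Ideal.span {(C ((p : ℕ) : unrIntegers p) : UnrSeries p)}) ^ m) :
    C (((p : ℕ) : unrIntegers p) ^ a) * PowerSeries.map (toUnr p) F ∈
      Ideal.span ({L} : Set (UnrSeries p)) := by
  -- pad level `0` with `X` itself (all requirements are guarded by `1 ≤ m`)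
  have hall : ∀ m : ℕ, ∃ (Nm : Type) (_ : AddCommGroup Nm) (_ : Module (IwasawaAlgebra p) Nm)
      (_ : Module.Finite (IwasawaAlgebra p) Nm) (Lm : UnrSeries p),
      (1 ≤ m → Nonempty ((X ⧸ ((Ideal.span {(C (p : ℤ_[p]) : IwasawaAlgebra p)}) ^ m •
            (⊤ : Submodule (IwasawaAlgebra p) X))) ≃ₗ[IwasawaAlgebra p]
          (Nm ⧸ ((Ideal.span {(C (p : ℤ_[p]) : IwasawaAlgebra p)}) ^ m •
            (⊤ : Submodule (IwasawaAlgebra p) Nm))))) ∧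
      (1 ≤ m → (Module.fittingIdeal (IwasawaAlgebra p) Nm 0).map (PowerSeries.map (toUnr p)) ≤
          Ideal.span {Lm}) ∧
      (1 ≤ m → Ideal.span {Lm} ⊔ (Ideal.span {(C ((p : ℕ) : unrIntegers p) : UnrSeries p)}) ^ m =
          Ideal.span {L} ⊔ (Ideal.span {(C ((p : ℕ) : unrIntegers p) : UnrSeries p)}) ^ m) := by
    intro m
    rcases Nat.eq_zero_or_pos m with rfl | hm
    · exact ⟨X, inferInstance, inferInstance, inferInstance, L, fun h ↦ absurd h (by decide),
        fun h ↦ absurd h (by decide), fun h ↦ absurd h (by decide)⟩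
    · obtain ⟨Nm, i1, i2, i3, Lm, he, hF, hc⟩ := hmem m hm
      exact ⟨Nm, i1, i2, i3, Lm, fun _ ↦ he, fun _ ↦ hF, fun _ ↦ hc⟩
  choose N iA iM iF Lm he hF hc using hall
  exact @HidaLimitAlgebra.C_pow_mul_map_mem_span_of_oneSided_congruences p _ X _ _ _ N iA iM iF F a
    hfitt L Lm (fun m hm ↦ Classical.choice (he m hm)) (fun m hm ↦ hF m hm) (fun m hm ↦ hc m hm)

variable {W : WeierstrassCurve ℚ} [W.IsElliptic] [W.IsGloballyMinimal]

omit [W.IsGloballyMinimal] in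
/-- **Road H's inputs ⟹ road H's output, pointwise**: under `HidaLimitInputsAt W p`, at every datum
and `R₀`-frame `L` and every generator `F` of `Ch_Λ(X_ac^∅)`: `∃ a, C(p^a)·F^nr ∈ (L)` — verbatim the
body of `X2.HidaLimitRevDivOnTree` (p419866). `X_ac^∅` is finitely generated by the tree's PROVED
`XAc.module_finite_empty`; the rest is `C_pow_mul_map_mem_of_memberData`. CONDITIONAL on the typed
inputs; nothing booked. [cite: KellerYin2024, §5.1 (a)–(e) and Lemma 5.1.2 (arXiv:2402.12781v2)]
[cite: Skinner2016PacificMC, §3.1 (p. 192)] -/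
theorem C_pow_mul_map_mem_of_hidaLimitInputs (hin : HidaLimitInputsAt W p)
    (N : ℕ) [NeZero N] (K : Type) [Field K] [NumberField K] (Dt : ModularParametrizationData W N)
    (H : HeegnerDatum N (NumberField.discr K)) (ιK : K →+* ℂ) (P : (W.baseChange K).toAffine.Point)
    (hc : CellC W p) (hN : W.conductorNorm ℤ = N) (hK : IsImaginaryQuadratic K)
    (hd4 : NumberField.discr K < -4) (hHN : SatisfiesHeegnerHypothesis N K)
    (hLt : (W.quadraticTwist (NumberField.discr K : ℚ)).entireLFunction 1 ≠ 0)
    (hP : WeierstrassCurve.Affine.Point.map ιK.toRatAlgHom P = heegnerPointComplex Dt H)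
    (hcM : ¬ (p : ℤ) ∣ Dt.c) (hPinf : ¬ IsOfFinAddOrder P)
    (κ : ZpExtension K p) (hκ : κ.IsAnticyclotomic) (γ : Field.absoluteGaloisGroup K)
    [Fact (κ.IsTopGenerator γ)] (𝔭 : HeightOneSpectrum (𝓞 K)) (h𝔭 : ((p : ℕ) : 𝓞 K) ∈ 𝔭.asIdeal)
    (he : 𝔭.asIdeal.ramificationIdx (𝓞 ℚ) = 1) (hf : 𝔭.asIdeal.inertiaDeg (𝓞 ℚ) = 1)
    (f : CuspForm (CongruenceSubgroup.Gamma0 N) 2) (hfW : IsNewformOf W f) (ι' : PadicAlgCl p ≃+* ℂ)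
    (hι' : ∀ (w : InfinitePlace K) (k : 𝓞 K), k ∈ 𝔭.asIdeal ↔ ‖ι'.symm (w.embedding (k : K))‖ < 1)
    (ΩK : ℂ) (Ωp : (unrIntegers p)ˣ) (L : UnrSeries p) (hΩK : ΩK ≠ 0)
    (hL : IsBDPLFunction ι' 𝔭 κ γ f ΩK ((Ωp : unrIntegers p) : ℂ_[p]) L)
    (F : IwasawaAlgebra p) (hchar : XAc.charIdeal (W.baseChange K) p κ 𝔭 ∅ γ = Ideal.span {F}) :
    ∃ a : ℕ, C (((p : ℕ) : unrIntegers p) ^ a) * PowerSeries.map (toUnr p) F ∈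
      Ideal.span ({L} : Set (UnrSeries p)) := by
  obtain ⟨⟨a, hfitt⟩, hmem⟩ := hin N K Dt H ιK P hc hN hK hd4 hHN hLt hP hcM hPinf κ hκ γ 𝔭 h𝔭 he
    hf f hfW ι' hι' ΩK Ωp L hΩK hL F hchar
  haveI : Module.Finite (IwasawaAlgebra p) (XAc (W.baseChange K) p κ 𝔭 ∅ γ) :=
    XAc.module_finite_empty κ 𝔭 γ
  exact ⟨a, C_pow_mul_map_mem_of_memberData hfitt hmem⟩

end Transfer

/-! ### The glue to the IMC atom at BOTH signs: inputs + Keller–Yin D′ ⟹ c3 and c3s -/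

section Glue

variable {W : WeierstrassCurve ℚ} [W.IsElliptic] [W.IsGloballyMinimal] {p : ℕ} [Fact p.Prime]

omit [W.IsGloballyMinimal] in
/-- **Road H closes c3 (non-split)**: `HidaLimitInputsAt W p` + `NonsplitMuLambdaOnTree W p` (KY D′:
first unit coefficients of `F^nr` and `L` at the same index) ⟹ `NonsplitIMCEqOnTree W p`
(`Ch_Λ(X_ac^∅)·R₀⟦T⟧ = (L)` at every non-split X2c Heegner datum): the transfer gives
`C(p^a)·F^nr ∈ (L)`, and `span_singleton_eq_of_C_pow_mul_mem` (p406792) with the roles of `F` and `L`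
exchanged closes. CONDITIONAL on the two typed hypotheses; nothing booked.
[cite: KellerYin2024, Lemma 5.1.2 and proof of Thm. 3.0.8 (arXiv:2402.12781v2)] [cite: Washington1997, §7.1 Prop. 7.2] -/
theorem nonsplitIMCEqOnTree_of_hidaLimitInputs_of_muLambda (hin : HidaLimitInputsAt W p)
    (hml : NonsplitMuLambdaOnTree W p) : NonsplitIMCEqOnTree W p := by
  intro N _ K _ _ Dt H ιK P hc hns hN hK hd4 hHN hLt hP hcM hPinf κ hκ γ _ 𝔭 h𝔭 he hf f hfW ι' hι'
    ΩK Ωp L hΩK hL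
  obtain ⟨F, hF⟩ :=
    (charIdeal_isPrincipal_holds p (XAc (W.baseChange K) p κ 𝔭 ∅ γ)).principal
  have hchar : XAc.charIdeal (W.baseChange K) p κ 𝔭 ∅ γ = Ideal.span {F} := hF
  obtain ⟨a, ha⟩ := C_pow_mul_map_mem_of_hidaLimitInputs hin N K Dt H ιK P hc hN hK hd4 hHN hLt hP
    hcM hPinf κ hκ γ 𝔭 h𝔭 he hf f hfW ι' hι' ΩK Ωp L hΩK hL F hchar
  obtain ⟨n, hFn, hLn⟩ := hml N K Dt H ιK P hc hns hN hK hd4 hHN hLt hP hcM hPinf κ hκ γ 𝔭 h𝔭 he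
    hf f hfW ι' hι' ΩK Ωp L hΩK hL F hchar
  unfold R1.IMCEqOnTreeAt
  rw [hchar, Ideal.map_span, Set.image_singleton]
  exact (span_singleton_eq_of_C_pow_mul_mem ha hLn hFn).symm

omit [W.IsGloballyMinimal] in
/-- **Road H closes c3s (split)**: `HidaLimitInputsAt W p` + `SplitMuLambdaOnTree W p` ⟹
`SplitIMCEqOnTree W p` — the same transfer and algebra with the split D′ half (p416318); road H is
sign-free, so ONE input predicate serves both signs. CONDITIONAL; nothing booked.
[cite: KellerYin2024, §5.1 and Thm. 5.1.3 = Thm. D (arXiv:2402.12781v2), no sign hypothesis]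
[cite: Washington1997, §7.1 Prop. 7.2] -/
theorem splitIMCEqOnTree_of_hidaLimitInputs_of_muLambda (hin : HidaLimitInputsAt W p)
    (hml : SplitMuLambdaOnTree W p) : SplitIMCEqOnTree W p := by
  intro N _ K _ _ Dt H ιK P hc hs hN hK hd4 hHN hLt hP hcM hPinf κ hκ γ _ 𝔭 h𝔭 he hf f hfW ι' hι'
    ΩK Ωp L hΩK hL
  obtain ⟨F, hF⟩ :=
    (charIdeal_isPrincipal_holds p (XAc (W.baseChange K) p κ 𝔭 ∅ γ)).principal
  have hchar : XAc.charIdeal (W.baseChange K) p κ 𝔭 ∅ γ = Ideal.span {F} := hF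
  obtain ⟨a, ha⟩ := C_pow_mul_map_mem_of_hidaLimitInputs hin N K Dt H ιK P hc hN hK hd4 hHN hLt hP
    hcM hPinf κ hκ γ 𝔭 h𝔭 he hf f hfW ι' hι' ΩK Ωp L hΩK hL F hchar
  obtain ⟨n, hFn, hLn⟩ := hml N K Dt H ιK P hc hs hN hK hd4 hHN hLt hP hcM hPinf κ hκ γ 𝔭 h𝔭 he
    hf f hfW ι' hι' ΩK Ωp L hΩK hL F hchar
  unfold R1.IMCEqOnTreeAt
  rw [hchar, Ideal.map_span, Set.image_singleton]
  exact (span_singleton_eq_of_C_pow_mul_mem ha hLn hFn).symm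

omit [W.IsGloballyMinimal] in
/-- **The IMC atom of crux 4 at BOTH signs from road H**: `HidaLimitInputsAt` + D′ at both signs ⟹
c3 ∧ c3s; combined with the Kolyvagin halves (p408417, p416318) the atom reads
`(c3-div ∨ HidaLimitInputs) ∧ c3-μλ` at either sign. CONDITIONAL; nothing booked. [folklore] -/
theorem imcEq_both_signs_of_div_or_hidaLimitInputs_of_muLambda
    (h : (NonsplitKolyvaginDivOnTree W p ∧ SplitKolyvaginDivOnTree W p) ∨ HidaLimitInputsAt W p)
    (hml : NonsplitMuLambdaOnTree W p) (hmls : SplitMuLambdaOnTree W p) :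
    NonsplitIMCEqOnTree W p ∧ SplitIMCEqOnTree W p := by
  rcases h with ⟨hd, hds⟩ | hin
  · exact ⟨nonsplitIMCEqOnTree_of_div_of_muLambda hd hml,
      splitIMCEqOnTree_of_div_of_muLambda hds hmls⟩
  · exact ⟨nonsplitIMCEqOnTree_of_hidaLimitInputs_of_muLambda hin hml,
      splitIMCEqOnTree_of_hidaLimitInputs_of_muLambda hin hmls⟩

end Glue

end Summit.BirchSwinnertonDyer.Rank1Residual.X2

end
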